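import Summits.ResolutionOfSingularities.ResolutionOfSingularities.Theorems.MarkedTransferCampaignW46ThreefoldsGammaFreeGlobalPointCentre
import Literature.AlgebraicGeometry.Resolution.RegularSubschemeLocallyIrreducible
import Literature.AlgebraicGeometry.Resolution.QuasiExcellentClosedSubschemes
import Literature.AlgebraicGeometry.Resolution.ComponentGluing
import Literature.Topology.KrullDimensionDrop
import HarnessLib

/-!
# [OURS · L1 W4.6 rung (ii), dimension ladder] THE FAMILY OF PRIME DIVISORS OF A SURFACE INPUT AS INTEGRAL CURVES
# (brick B10a of rung (ii-2) `GammaFreeGlobalOrderReductionDimLE p 2`)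

Cell res-hironaka, LADDER-RESOLUTION rung L (D-0089), slot W4.6, rung (ii) (dimension ladder, res-L1-type-o1 p496755); seat
res-D-pv-049 AS res-L1-s46-pv-11 (holder of rung (ii-2); architecture v2, STATUS 2026-08-27T05:4xZ). Host route MarkedTransfer, host
item `HypersurfaceOrderReductionDimLeThree` (stmt-ResolutionOfSingularities-16156); proposed `--kind proof --supports` it `--as helper`.
Everything here is OURS scheme theory over the tree's library; nothing of H. Hironaka's manuscript [Hironaka2017] is asserted.
AI-written; AI review is weaker than expert review.

## What is proved (the entry point of the d = 2 loop, whose state carries its prime divisors as integral curves `C_k ↪ X`)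

* `ker_eq_primeDivisorIdeal_of_isIntegral` — the kernel ideal sheaf of a closed immersion `i : C ↪ X` of an INTEGRAL scheme is
  the reduced ideal `𝓘_{cl (i η_C)}` of the closure of the image of its generic point (a reduced closed immersion's kernel is the
  reduced ideal of its image, Stacks 01J3). This identifies the loop's curve data with the prime divisors `primeDivisorIdeal ζ`
  used by the SNC end-game (brick B7) and by the divisorial factorization.
* `exists_primeDivisorFamily` — on an integral Noetherian quasi-excellent scheme `X` of dimension `≤ 2`, the finitely many
  codimension-one points `ζ` of `V(I)` (`I ≠ 0`) are the images of the generic points of a FINITE FAMILY of closed immersions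
  `i_k : C_k ↪ X` of integral Noetherian quasi-excellent schemes of dimension `≤ 1`, injective on generic points — namely the reduced
  closed subschemes `cl{ζ} ↪ X`. This is the shape in which bricks B4/B8b (strict transforms, `δ`-bookkeeping) consume a component.

## Sources

* The Stacks Project, Tags 01J3 (reduced induced closed subscheme), 0BE1. [StacksProject]
* Q. Liu, *Algebraic Geometry and Arithmetic Curves* (2002), §2.4 (reduced subschemes), §8.2 (excellent schemes). [Liu2002]
* H. Hironaka, ms. 2017-03-23, §2.1 p.4 — scope only, under adjudication, not cited as fact. [Hironaka2017]
-/

noncomputable section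

set_option linter.dupNamespace false -- mandated namespace of this single-conjunct summit

open CategoryTheory AlgebraicGeometry TopologicalSpace IsLocalRing Topology

namespace Summit.ResolutionOfSingularities.ResolutionOfSingularities.Theorems

namespace CampaignW46

open Literature.AlgebraicGeometry.Resolution
open Scheme.IdealSheafData

universe u

/-! ## The kernel of a closed immersion from an integral scheme -/

/-- **The kernel of a closed immersion from an integral scheme is the prime-divisor ideal of the image of its generic point**:
`ker i = 𝓘_{cl (i η_C)}` (the image is closed with generic point `i η_C`; the kernel of a reduced closed immersion is the reduced
ideal of its image). [cite: StacksProject, Tag 01J3] -/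
theorem ker_eq_primeDivisorIdeal_of_isIntegral {X C : Scheme.{u}} (i : C ⟶ X) [IsClosedImmersion i] [IsIntegral C] :
    i.ker = primeDivisorIdeal (i (genericPoint C)) := by
  have hker : (i.ker).subschemeι.ker = i.ker := ker_subschemeι _
  haveI : IsIso (IsClosedImmersion.lift (i.ker).subschemeι i hker.le) := IsClosedImmersion.isIso_lift _ _ hker
  haveI : IsReduced (i.ker).subscheme :=
    isReduced_of_isOpenImmersion (inv (IsClosedImmersion.lift (i.ker).subschemeι i hker.le))
  have h1 : vanishingIdeal (i.ker).support = i.ker := eq_vanishingIdeal_support_of_isReduced_subscheme _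
  have hsupp : ((i.ker).support : Set X) = closure {i (genericPoint C)} := by
    rw [Scheme.Hom.support_ker, i.isClosedEmbedding.isClosed_range.closure_eq, ← Set.image_univ,
      ← genericPoint_closure, ← i.isClosedEmbedding.closure_image_eq, Set.image_singleton]
  rw [← h1, primeDivisorIdeal]
  congr 1
  exact Closeds.ext hsupp

/-! ## The reduced closed subscheme on a prime divisor of a surface is an integral curve -/

/-- The generic point of the reduced closed subscheme `cl{ζ} ↪ X` maps to `ζ`. [folklore] -/
theorem subschemeι_genericPoint_primeDivisorIdeal {X : Scheme.{u}} (ζ : X) :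
    haveI : IsIntegral (primeDivisorIdeal ζ).subscheme :=
      isIntegral_subscheme_vanishingIdeal _ isIrreducible_singleton.closure
    (primeDivisorIdeal ζ).subschemeι (genericPoint (primeDivisorIdeal ζ).subscheme) = ζ := by
  haveI : IsIntegral (primeDivisorIdeal ζ).subscheme := isIntegral_subscheme_vanishingIdeal _ isIrreducible_singleton.closure
  set i := (primeDivisorIdeal ζ).subschemeι
  have h : IsGenericPoint (i (genericPoint _)) (closure (i '' Set.univ)) :=
    (genericPoint_spec (primeDivisorIdeal ζ).subscheme).image i.continuous
  rw [Set.image_univ, Scheme.IdealSheafData.range_subschemeι, coe_support_primeDivisorIdeal, closure_closure] at h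
  exact h.eq isGenericPoint_closure

/-- **[OURS · W4.6 rung (ii-2), brick B10a] The prime divisors of `V(I)` on an integral Noetherian quasi-excellent scheme of
dimension `≤ 2` as a finite family of integral curves.** For `I ≠ 0` there are `n`, integral Noetherian quasi-excellent schemes
`C_k` (`k < n`) of dimension `≤ 1` and closed immersions `i_k : C_k ↪ X` such that `k ↦ i_k(η_{C_k})` is a bijection onto the
set of codimension-one points of `V(I)` (`divisorialPoints I`). [cite: StacksProject, Tag 0BE1] -/
theorem exists_primeDivisorFamily {X : Scheme.{u}} [IsIntegral X] [IsNoetherian X] (hXq : Scheme.IsQuasiExcellent X)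
    (hdim : topologicalKrullDim X ≤ 2) {I : X.IdealSheafData} (hI : I ≠ ⊥) :
    ∃ (n : ℕ) (ζ : Fin n → X) (C : Fin n → Scheme.{u}) (i : ∀ k, C k ⟶ X),
      Function.Injective ζ ∧ Set.range ζ = divisorialPoints I ∧
      ∀ k, IsClosedImmersion (i k) ∧ ∃ (_ : IsIntegral (C k)) (_ : IsNoetherian (C k)),
        Scheme.IsQuasiExcellent (C k) ∧ topologicalKrullDim (C k) ≤ 1 ∧ i k (genericPoint (C k)) = ζ k := by
  classical
  have hfin := finite_divisorialPoints hI
  have e : Fin hfin.toFinset.card ≃ hfin.toFinset := hfin.toFinset.equivFin.symm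
  let ζ : Fin hfin.toFinset.card → X := fun k => (e k : X)
  have hζmem : ∀ k, ζ k ∈ divisorialPoints I := fun k => hfin.mem_toFinset.mp (e k).2
  refine ⟨hfin.toFinset.card, ζ, fun k => (primeDivisorIdeal (ζ k)).subscheme, fun k => (primeDivisorIdeal (ζ k)).subschemeι,
    fun k l h => e.injective (Subtype.ext h), ?_, fun k => ⟨inferInstance, ?_⟩⟩
  · ext ξ
    constructor
    · rintro ⟨k, rfl⟩
      exact hζmem k
    · intro hξ
      refine ⟨e.symm ⟨ξ, hfin.mem_toFinset.mpr hξ⟩, ?_⟩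
      change ((e (e.symm ⟨ξ, _⟩) : hfin.toFinset) : X) = ξ
      rw [Equiv.apply_symm_apply]
  · haveI hint : IsIntegral (primeDivisorIdeal (ζ k)).subscheme :=
      isIntegral_subscheme_vanishingIdeal _ isIrreducible_singleton.closure
    haveI : IsLocallyNoetherian (primeDivisorIdeal (ζ k)).subscheme :=
      LocallyOfFiniteType.isLocallyNoetherian (primeDivisorIdeal (ζ k)).subschemeι
    haveI : CompactSpace (primeDivisorIdeal (ζ k)).subscheme :=
      QuasiCompact.compactSpace_of_compactSpace (primeDivisorIdeal (ζ k)).subschemeι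
    haveI hN : IsNoetherian (primeDivisorIdeal (ζ k)).subscheme := {}
    refine ⟨hint, hN, Scheme.IsQuasiExcellent.of_isClosedImmersion (primeDivisorIdeal (ζ k)).subschemeι hXq, ?_,
      subschemeι_genericPoint_primeDivisorIdeal (ζ k)⟩
    -- `cl{ζ}` is a proper closed subset of the surface `X`, of dimension `≤ 1`
    have hW : IsClosed (closure ({ζ k} : Set X)) := isClosed_closure
    have hWX : closure ({ζ k} : Set X) ≠ Set.univ := by
      intro h
      have hsub : closure ({ζ k} : Set X) ⊆ (I.support : Set X) :=
        closure_minimal (Set.singleton_subset_iff.mpr (hζmem k).1) I.support.isClosed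
      exact not_mem_support_genericPoint hI (hsub (h ▸ Set.mem_univ _))
    have hlt : topologicalKrullDim (closure ({ζ k} : Set X)) < ((2 : ℕ) : WithBot ℕ∞) :=
      Literature.Topology.topologicalKrullDim_lt_of_isClosed_ssubset hW hWX 2
        (lt_of_le_of_lt hdim (by exact_mod_cast WithBot.coe_lt_coe.mpr (by decide)))
    have hle : topologicalKrullDim (closure ({ζ k} : Set X)) ≤ (1 : ℕ) := by
      rw [show ((2 : ℕ) : WithBot ℕ∞) = ((1 : ℕ) : WithBot ℕ∞) + 1 by norm_num] at hlt
      exact ENat.WithBot.lt_add_one_iff.mp hlt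
    -- the subscheme maps, as an inducing map, INTO `cl{ζ}`
    set i := (primeDivisorIdeal (ζ k)).subschemeι
    have hrange : ∀ c, i c ∈ closure ({ζ k} : Set X) := fun c => by
      have : i c ∈ Set.range i := ⟨c, rfl⟩
      rwa [Scheme.IdealSheafData.range_subschemeι, coe_support_primeDivisorIdeal] at this
    have hind : IsInducing (Set.codRestrict i (closure ({ζ k} : Set X)) hrange) :=
      i.isClosedEmbedding.isInducing.codRestrict hrange
    exact hind.topologicalKrullDim_le.trans (by exact_mod_cast hle)

end CampaignW46

end Summit.ResolutionOfSingularities.ResolutionOfSingularities.Theorems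

end
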